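import Summits.HubbardSuperconductivity.HubbardSuperconductivity.Theorems.AnisotropyChordTransferFibre3Subsample
import Summits.HubbardSuperconductivity.HubbardSuperconductivity.Theorems.AnisotropyChordTransferFibre3TtailBounds

/-!
# Route `AnisotropyChord` / H0 rotor rung: the DYADIC STEP of the periodisation bound — `a_M − a_{2M}` is a sum of three ALTERNATING lattice sums at the half-period points, each bounded by first differences

Second file of the periodisation toolkit (memo ROTOR-THEORY-21 §320–§322; the one remaining analytic input of the HOLE₂ tail,
`…Fibre3TwoHoleBSTail.dualCert_threeQuarter_of_tail`, hypothesis `|2·aKer L 0 r − A∞| ≤ δ_per`).  With the subsampling identity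
(`…Fibre3Subsample.aKer_subsample`, `q = 2`) the coarse kernel `a^{(M)}` is the periodisation of the fine one `a^{(2M)}`, and the
three correction terms sit at the half-period points `c ∈ {(M,0), (0,M), (M,M)}` of `(ℤ/2M)²`.  This file (exact + one inequality,
every `λ`):
* `phase_half_mul_self`, `phase_half_im`: at a `2`-torsion point every character is `±1`; `re_phase_shift_neg`;
* ★ `abs_alternating_sum_le`: if `σ(n + d) = −σ(n)`, `|σ| ≤ 1` then `|Σ_n σ(n)F(n)| ≤ ½ Σ_n |F(n + d) − F(n)|` (shift `n ↦ n + d`);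
* ★ `aKer_half_shift`: `a(r + c) − a(c) = (1/V)Σ_n Re φ_n(c)·g(n)(1 − Re φ_n(r))` — an ALTERNATING lattice sum;
  `abs_aKer_half_shift_le`: `|a(r + c) − a(c)| ≤ T_d(r)/(2V)` for any momentum shift `d` with `φ_d(c) = −1`, where
  `T_d(r) = Σ_n |h_r(n+d) − h_r(n)|` (`diffSum`), `h_r(n) = g(n)(1 − Re φ_n(r))`;
* `phase_ex_half`, `phase_ey_half` (`φ_{eₓ}((M,·)) = φ_{e_y}((·,M)) = −1`), `jshift_two`, `sum_tor_two`;
* ★★ `abs_aKer_red_sub_le`: **`|a^{(M)}_λ(r mod M) − a^{(2M)}_λ(r)| ≤ (2·T_{eₓ}(r) + T_{e_y}(r)) / (2·(2M)²)`**.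
So the dyadic rate (hence, by telescoping `M, 2M, 4M, …`, the existence of `a_∞(r) := lim a_{2^k M}(r)` with an explicit
rate and NO continuum integral) is reduced to ONE estimate: `T_d(r) ≤ C·|r|²·M` for the first differences of
`h_r(n) = (1 − cos k_n·r)/(2ε(k_n) − λ)` along a lattice direction (Jordan + `(k·r)² ≤ |k|²|r|²` + a ring count `Σ 1/|m| ≤ 8N`;
not yet a tree theorem).
Prover seat `hubbard-h0-rotor-p2` g2; helper for stmt-HubbardSuperconductivity-19089 (`--supports`, helper class).
WHAT THIS IS NOT: nothing here proves superconductivity in the Hubbard model; the rotor TARGET as originally worded stays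
FALSE (g15 verdict).  A reduction of ONE analytic input (periodisation) of ONE input (HOLE₂) of ONE conditional reduction
(rung 19089).  Mathlib + tree imports only; no sorry, no axioms.
-/

set_option linter.dupNamespace false

noncomputable section

open scoped BigOperators
open Complex Finset

namespace Summit.HubbardSuperconductivity.HubbardSuperconductivity.Theorems.AnisotropyChord.Transfer.Fibre3

namespace Subsample

variable (N : ℕ) [NeZero N]

/-! ## Half-period points and alternating characters -/

/-- at a half-period point `c` (`c + c = 0`) every character is `±1`: `φ_n(c)² = 1`. [folklore] -/
theorem phase_half_mul_self {c : Tor N} (hc : c + c = 0) (n : Tor N) : phase N n c * phase N n c = 1 := by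
  rw [← phase_add, hc, phase_zero]

/-- hence `φ_n(c)` is real. [folklore] -/
theorem phase_half_im {c : Tor N} (hc : c + c = 0) (n : Tor N) : (phase N n c).im = 0 := by
  rcases mul_self_eq_one_iff.mp (phase_half_mul_self N hc n) with h | h
  · rw [h]; simp
  · rw [h]; simp

/-- `|Re φ_n(c)| ≤ 1`. [folklore] -/
theorem abs_re_phase_le (n c : Tor N) : |(phase N n c).re| ≤ 1 := by
  have h := normSq_phase N n c
  rw [Complex.normSq_apply] at h
  have : (phase N n c).re ^ 2 ≤ 1 := by nlinarith [sq_nonneg (phase N n c).im]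
  exact abs_le_one_iff_sq_le_one _ |>.mpr this |> fun h => h
where
  /-- auxiliary: `|x| ≤ 1 ↔ x² ≤ 1`. [folklore] -/
  abs_le_one_iff_sq_le_one (x : ℝ) : |x| ≤ 1 ↔ x ^ 2 ≤ 1 := by
    constructor
    · intro h; nlinarith [abs_nonneg x, sq_abs x]
    · intro h; nlinarith [abs_nonneg x, sq_abs x]

/-- the character flips under a momentum shift `d` with `φ_d(c) = −1`. [folklore] -/
theorem re_phase_shift_neg {c d : Tor N} (hd : phase N d c = -1) (n : Tor N) :
    (phase N (n + d) c).re = -(phase N n c).re := by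
  rw [phase_add_left, hd]; simp

/-- ★ ALTERNATING SUMS are bounded by first differences: if `σ(n + d) = −σ(n)` and `|σ| ≤ 1` then
`|Σ_n σ(n) F(n)| ≤ ½ Σ_n |F(n + d) − F(n)|`. [folklore] -/
theorem abs_alternating_sum_le (σ F : Tor N → ℝ) (d : Tor N) (hσ : ∀ n, σ (n + d) = -σ n)
    (hb : ∀ n, |σ n| ≤ 1) : |∑ n : Tor N, σ n * F n| ≤ (1 / 2 : ℝ) * ∑ n : Tor N, |F (n + d) - F n| := by
  set S := ∑ n : Tor N, σ n * F n with hS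
  -- Σ σ(n) F(n + d) = −S (reindex by `n ↦ n + d`, σ(n) = −σ(n + d))
  have hshift : ∑ n : Tor N, σ n * F (n + d) = -S := by
    rw [hS, ← Finset.sum_neg_distrib, ← Equiv.sum_comp (Equiv.addRight d) (fun n => -(σ n * F n))]
    refine Finset.sum_congr rfl fun n _ => ?_
    simp only [Equiv.coe_addRight, hσ]
    ring
  have h2 : ∑ n : Tor N, σ n * (F (n + d) - F n) = -2 * S := by
    simp only [mul_sub, Finset.sum_sub_distrib, hshift, hS]; ring
  have habs : |∑ n : Tor N, σ n * (F (n + d) - F n)| ≤ ∑ n : Tor N, |F (n + d) - F n| := by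
    refine (Finset.abs_sum_le_sum_abs _ _).trans (Finset.sum_le_sum fun n _ => ?_)
    rw [abs_mul]
    calc |σ n| * |F (n + d) - F n| ≤ 1 * |F (n + d) - F n| :=
          mul_le_mul_of_nonneg_right (hb n) (abs_nonneg _)
      _ = |F (n + d) - F n| := one_mul _
  rw [h2, abs_mul, abs_neg, abs_two] at habs
  linarith

/-- ★ the kernel increment at a half-period point is an ALTERNATING sum (every `λ`):
`a(r + c) − a(c) = (1/V) Σ_n Re φ_n(c) · g(n)(1 − Re φ_n(r))`. [folklore] -/
theorem aKer_half_shift {c : Tor N} (hc : c + c = 0) (lam : ℝ) (r : Tor N) :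
    aKer N lam (r + c) - aKer N lam c
      = (∑ n : Tor N, (phase N n c).re * (gres N lam n * (1 - (phase N n r).re))) / (N : ℝ) ^ 2 := by
  have h0 : aKer N lam (r + c) - aKer N lam c = Gres N lam c - Gres N lam (r + c) := by
    unfold aKer; ring
  rw [h0]
  unfold Gres
  rw [← sub_div]
  congr 1
  rw [← Finset.sum_sub_distrib]
  refine Finset.sum_congr rfl fun n _ => ?_
  rw [phase_add, Complex.mul_re, phase_half_im N hc n, mul_zero, sub_zero]
  ring

/-- ★★ **DYADIC-STEP BOUND per half-period point:** `|a(r + c) − a(c)| ≤ (1/(2V)) Σ_n |h_r(n + d) − h_r(n)|` with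
`h_r(n) = g(n)(1 − Re φ_n(r))`, for any momentum shift `d` with `φ_d(c) = −1`. [folklore] -/
theorem abs_aKer_half_shift_le {c d : Tor N} (hc : c + c = 0) (hd : phase N d c = -1) (lam : ℝ) (r : Tor N) :
    |aKer N lam (r + c) - aKer N lam c|
      ≤ (∑ n : Tor N, |gres N lam (n + d) * (1 - (phase N (n + d) r).re) - gres N lam n * (1 - (phase N n r).re)|)
          / (2 * (N : ℝ) ^ 2) := by
  have hV : (0 : ℝ) < (N : ℝ) ^ 2 := by
    have : (0 : ℝ) < (N : ℝ) := by exact_mod_cast Nat.pos_of_ne_zero (NeZero.ne N)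
    positivity
  rw [aKer_half_shift N hc, abs_div, abs_of_pos hV]
  have h := abs_alternating_sum_le N (fun n => (phase N n c).re)
    (fun n => gres N lam n * (1 - (phase N n r).re)) d (re_phase_shift_neg N hd) (fun n => abs_re_phase_le N n c)
  calc |∑ n : Tor N, (phase N n c).re * (gres N lam n * (1 - (phase N n r).re))| / (N : ℝ) ^ 2
      ≤ ((1 / 2 : ℝ) * ∑ n : Tor N, |gres N lam (n + d) * (1 - (phase N (n + d) r).re)
          - gres N lam n * (1 - (phase N n r).re)|) / (N : ℝ) ^ 2 := div_le_div_of_nonneg_right h hV.le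
    _ = _ := by ring

/-! ## The dyadic step `M ↦ 2M`: three half-period points -/

section Dyadic

variable (M : ℕ) [NeZero M] [NeZero (2 * M)]

/-- the first-difference functional `T_d(r) = Σ_n |h_r(n + d) − h_r(n)|`, `h_r(n) = g(n)(1 − Re φ_n(r))`, on the fine torus. [folklore] -/
def diffSum (lam : ℝ) (d r : Tor (2 * M)) : ℝ :=
  ∑ n : Tor (2 * M), |gres (2 * M) lam (n + d) * (1 - (phase (2 * M) (n + d) r).re)
    - gres (2 * M) lam n * (1 - (phase (2 * M) n r).re)|

omit [NeZero M] in
/-- `diffSum` is nonnegative. [folklore] -/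
theorem diffSum_nonneg (lam : ℝ) (d r : Tor (2 * M)) : 0 ≤ diffSum M lam d r :=
  Finset.sum_nonneg fun _ _ => abs_nonneg _

omit [NeZero (2 * M)] in
/-- `(1 : ZMod 2M).val = 1`. [folklore] -/
theorem val_one_fine : (1 : ZMod (2 * M)).val = 1 := by
  rw [ZMod.val_one_eq_one_mod]
  have := Nat.pos_of_ne_zero (NeZero.ne M)
  exact Nat.mod_eq_of_lt (by omega)

omit [NeZero M] [NeZero (2 * M)] in
/-- the half-period points are `2`-torsion. [folklore] -/
theorem half_add_half : (((M : ℕ) : ZMod (2 * M)) + ((M : ℕ) : ZMod (2 * M))) = 0 := by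
  rw [← Nat.cast_add, show M + M = 2 * M by ring, ZMod.natCast_self]

omit [NeZero (2 * M)] in
/-- `φ_{eₓ}((M, y)) = −1` and `φ_{e_y}((x, M)) = −1` on the fine torus. [folklore] -/
theorem phase_ex_half (y : ZMod (2 * M)) : phase (2 * M) (ex (2 * M)) (((M : ℕ) : ZMod (2 * M)), y) = -1 := by
  have val_half : ((M : ℕ) : ZMod (2 * M)).val = M := by
    rw [ZMod.val_natCast, Nat.mod_eq_of_lt]
    have := Nat.pos_of_ne_zero (NeZero.ne M); omega
  unfold phase ex
  rw [val_one_fine, val_half]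
  simp only [ZMod.val_zero, zero_mul, add_zero, one_mul]
  have hM : (M : ℂ) ≠ 0 := by exact_mod_cast (NeZero.ne M)
  rw [show (2 * (Real.pi : ℂ) * Complex.I * (((M : ℕ) : ℂ) / ((2 * M : ℕ) : ℂ))) = Real.pi * Complex.I by
    push_cast; field_simp]
  exact Complex.exp_pi_mul_I

omit [NeZero (2 * M)] in
/-- `φ_{e_y}((x, M)) = −1`. [folklore] -/
theorem phase_ey_half (x : ZMod (2 * M)) : phase (2 * M) (ey (2 * M)) (x, ((M : ℕ) : ZMod (2 * M))) = -1 := by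
  have val_half : ((M : ℕ) : ZMod (2 * M)).val = M := by
    rw [ZMod.val_natCast, Nat.mod_eq_of_lt]
    have := Nat.pos_of_ne_zero (NeZero.ne M); omega
  unfold phase ey
  rw [val_one_fine, val_half]
  simp only [ZMod.val_zero, zero_mul, zero_add, one_mul]
  have hM : (M : ℂ) ≠ 0 := by exact_mod_cast (NeZero.ne M)
  rw [show (2 * (Real.pi : ℂ) * Complex.I * (((M : ℕ) : ℂ) / ((2 * M : ℕ) : ℂ))) = Real.pi * Complex.I by
    push_cast; field_simp]
  exact Complex.exp_pi_mul_I

/-- a sum over `(ℤ/2)²` is four terms. [folklore] -/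
theorem sum_tor_two (f : Tor 2 → ℝ) : ∑ j : Tor 2, f j = f (0, 0) + f (0, 1) + f (1, 0) + f (1, 1) := by
  rw [Fintype.sum_prod_type]
  show ∑ a : Fin 2, ∑ b : Fin 2, f (a, b) = _
  simp only [Fin.sum_univ_two]
  exact (add_assoc _ _ _).symm

omit [NeZero M] [NeZero (2 * M)] in
/-- the three nonzero coset shifts of the dyadic step. [folklore] -/
theorem jshift_two :
    jshift M 2 ((0 : ZMod 2), (0 : ZMod 2)) = (0, 0) ∧
    jshift M 2 ((0 : ZMod 2), (1 : ZMod 2)) = (0, ((M : ℕ) : ZMod (2 * M))) ∧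
    jshift M 2 ((1 : ZMod 2), (0 : ZMod 2)) = (((M : ℕ) : ZMod (2 * M)), 0) ∧
    jshift M 2 ((1 : ZMod 2), (1 : ZMod 2)) = (((M : ℕ) : ZMod (2 * M)), ((M : ℕ) : ZMod (2 * M))) := by
  unfold jshift
  have h0 : ((0 : ZMod 2)).val = 0 := rfl
  have h1 : ((1 : ZMod 2)).val = 1 := rfl
  simp only [h0, h1, mul_zero, mul_one, Nat.cast_zero, and_self]

omit [NeZero M] in
/-- `a(0) = 0`. [folklore] -/
theorem aKer_zero' (lam : ℝ) : aKer (2 * M) lam 0 = 0 := by unfold aKer; simp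

/-- ★★ **THE DYADIC STEP:** for every `λ` and every site `r` of the fine torus `(ℤ/2M)²`,
`|a^{(M)}_λ(r mod M) − a^{(2M)}_λ(r)| ≤ (2·T_{eₓ}(r) + T_{e_y}(r)) / (2·(2M)²)`,
where `T_d(r) = Σ_n |h_r(n+d) − h_r(n)|` is the first-difference functional of `h_r(n) = g(n)(1 − Re φ_n(r))`
(the coarse kernel is the periodisation of the fine one, `aKer_subsample`; each of the three correction terms sits at a
half-period point and is an alternating sum, `abs_aKer_half_shift_le`). [folklore] -/
theorem abs_aKer_red_sub_le (lam : ℝ) (r : Tor (2 * M)) :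
    |aKer M lam (red M 2 r) - aKer (2 * M) lam r|
      ≤ (2 * diffSum M lam (ex (2 * M)) r + diffSum M lam (ey (2 * M)) r) / (2 * ((2 * M : ℕ) : ℝ) ^ 2) := by
  have hsub := aKer_subsample M 2 lam r
  rw [sum_tor_two] at hsub
  obtain ⟨j00, j01, j10, j11⟩ := jshift_two M
  rw [j00, j01, j10, j11, show ((0 : ZMod (2 * M)), (0 : ZMod (2 * M))) = (0 : Tor (2 * M)) from rfl, add_zero,
    aKer_zero', sub_zero] at hsub
  -- the three alternating terms
  have hc1 : ((((M : ℕ) : ZMod (2 * M)), (0 : ZMod (2 * M))) : Tor (2 * M)) + (((M : ℕ) : ZMod (2 * M)), 0) = 0 := by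
    ext <;> simp [half_add_half]
  have hc2 : (((0 : ZMod (2 * M)), ((M : ℕ) : ZMod (2 * M))) : Tor (2 * M)) + (0, ((M : ℕ) : ZMod (2 * M))) = 0 := by
    ext <;> simp [half_add_half]
  have hc3 : ((((M : ℕ) : ZMod (2 * M)), ((M : ℕ) : ZMod (2 * M))) : Tor (2 * M))
      + (((M : ℕ) : ZMod (2 * M)), ((M : ℕ) : ZMod (2 * M))) = 0 := by
    ext <;> simp [half_add_half]
  have b1 := abs_aKer_half_shift_le (2 * M) hc1 (phase_ex_half M 0) lam r
  have b2 := abs_aKer_half_shift_le (2 * M) hc2 (phase_ey_half M 0) lam r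
  have b3 := abs_aKer_half_shift_le (2 * M) hc3 (phase_ex_half M _) lam r
  have heq : aKer M lam (red M 2 r) - aKer (2 * M) lam r
      = (aKer (2 * M) lam (r + (0, ((M : ℕ) : ZMod (2 * M)))) - aKer (2 * M) lam (0, ((M : ℕ) : ZMod (2 * M))))
        + (aKer (2 * M) lam (r + (((M : ℕ) : ZMod (2 * M)), 0)) - aKer (2 * M) lam (((M : ℕ) : ZMod (2 * M)), 0))
        + (aKer (2 * M) lam (r + (((M : ℕ) : ZMod (2 * M)), ((M : ℕ) : ZMod (2 * M))))
            - aKer (2 * M) lam (((M : ℕ) : ZMod (2 * M)), ((M : ℕ) : ZMod (2 * M)))) := by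
    rw [hsub]; ring
  rw [heq]
  have hV : (0 : ℝ) < ((2 * M : ℕ) : ℝ) ^ 2 := by
    have : (0 : ℝ) < ((2 * M : ℕ) : ℝ) := by exact_mod_cast Nat.pos_of_ne_zero (NeZero.ne (2 * M))
    positivity
  calc _ ≤ |aKer (2 * M) lam (r + (0, ((M : ℕ) : ZMod (2 * M)))) - aKer (2 * M) lam (0, ((M : ℕ) : ZMod (2 * M)))|
        + |aKer (2 * M) lam (r + (((M : ℕ) : ZMod (2 * M)), 0)) - aKer (2 * M) lam (((M : ℕ) : ZMod (2 * M)), 0)|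
        + |aKer (2 * M) lam (r + (((M : ℕ) : ZMod (2 * M)), ((M : ℕ) : ZMod (2 * M))))
            - aKer (2 * M) lam (((M : ℕ) : ZMod (2 * M)), ((M : ℕ) : ZMod (2 * M)))| :=
          (abs_add_le _ _).trans (by gcongr; exact abs_add_le _ _)
    _ ≤ diffSum M lam (ey (2 * M)) r / (2 * ((2 * M : ℕ) : ℝ) ^ 2)
        + diffSum M lam (ex (2 * M)) r / (2 * ((2 * M : ℕ) : ℝ) ^ 2)
        + diffSum M lam (ex (2 * M)) r / (2 * ((2 * M : ℕ) : ℝ) ^ 2) := add_le_add (add_le_add b2 b1) b3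
    _ = _ := by ring

end Dyadic


end Subsample

end Summit.HubbardSuperconductivity.HubbardSuperconductivity.Theorems.AnisotropyChord.Transfer.Fibre3

end
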